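import Summits.MatrixMultiplication.OmegaCensus.STPPHamidouneRodsethThreeRuns

/-!
# ω-census (abelian STPP census): Hamidoune–Rødseth for three-element sets — the case where every pair of `S` sees three runs (kernel)

HONEST FRAMING (pub-omega census; verbatim): lottery ticket; floor = certified bounds/negative ranges.
Census STRUCTURE / KERNEL desk (seat pub-omega-stpp-2 gen 24, 2026-08-28), family (b2).  Fourth file of the UNCONDITIONAL proof of
`HamidouneRodsethCard 3` (`STPPVosperSlackOneLawCard.lean`).  Nothing here is progress on `ω`.

## What is here

Normalised setting `S = {0, 1, v}`, `|T| ≥ 4`, `|T| + 7 ≤ p`, `|S + T| = |T| + 3`, and now ALL THREE differences of `S` see three run-ends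
of `T`: `|(1+T)∖T| = |(v+T)∖T| = |((v−1)+T)∖T| = 3`.  Then `U := T ∪ (1+T)` has `|U| = |T| + 3 = |S + T|`, so `S + T = U` and `v + T ⊆ U`.
* If `U` itself has three run-ends, `v + T` contains every run-start and every run-last point of `U` (the two count hypotheses), and a set
  squeezed between those with no more run-ends than `U` must be all of `U` (`eq_of_subset_of_ends`) — contradiction `|T| = |T| + 3`.
* Otherwise `|S + U| = |U ∪ (1+U)| ≤ |U| + 2 = |S| + |U| − 1`: the pair `(S, U)` is Vosper-critical, so `S` and `U` are progressions with one
  common difference `d`; `d = ±1` would give `U` a single run-end, so `2d = ±1`, and `T ⊆ U`, `1 + T ⊆ U` cut `U`'s `|T|+3` terms down to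
  `|T| + 1` for `T` (`hr3_of_all_runs_three`).

References: Y. O. Hamidoune, Ø. J. Rødseth, *An inverse theorem mod p*, Acta Arith. 92 (2000) 251–262 (the theorem, case `|A| = 3`);
A. G. Vosper, J. London Math. Soc. 31 (1956) (tree: `vosper_inverse`); M. B. Nathanson, GTM 165, Thm 2.7.
-/

open Finset
open scoped Pointwise

namespace Summit.MatrixMultiplication.OmegaCensus.HR3

open Literature.Combinatorics.Additive
open Literature.Combinatorics.Additive.Isoperimetric

variable {p : ℕ} [hp : Fact p.Prime]

/-! ## Run-end bookkeeping -/

/-- `|(−d + X) ∖ X| = |(d + X) ∖ X|`: run-ends and run-starts are equinumerous. [folklore] -/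
theorem card_neg_vadd_sdiff (X : Finset (ZMod p)) (d : ZMod p) : #((-d +ᵥ X) \ X) = #((d +ᵥ X) \ X) := by
  have h1 : (-d +ᵥ X) \ X = -d +ᵥ (X \ (d +ᵥ X)) := by
    rw [vadd_finset_sdiff, neg_vadd_vadd]
  rw [h1, card_vadd_finset]
  have h2 := card_sdiff_add_card_inter X (d +ᵥ X)
  have h3 := card_sdiff_add_card_inter (d +ᵥ X) X
  rw [card_vadd_finset, inter_comm] at h3
  omega

/-- Translating a set translates its run-ends: `|(1 + (c + X)) ∖ (c + X)| = |(1 + X) ∖ X|`. [folklore] -/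
theorem card_vadd_sdiff_vadd (X : Finset (ZMod p)) (c d : ZMod p) :
    #((d +ᵥ (c +ᵥ X)) \ (c +ᵥ X)) = #((d +ᵥ X) \ X) := by
  rw [vadd_vadd, add_comm, ← vadd_vadd, ← vadd_finset_sdiff, card_vadd_finset]

/-- `U = T ∪ (1 + T)` has no more run-ends than `T`: `(1 + U) ∖ U ⊆ 1 + ((1 + T) ∖ T)`. [folklore] -/
theorem card_vadd_sdiff_union_le (T : Finset (ZMod p)) :
    #(((1 : ZMod p) +ᵥ (T ∪ ((1 : ZMod p) +ᵥ T))) \ (T ∪ ((1 : ZMod p) +ᵥ T))) ≤ #(((1 : ZMod p) +ᵥ T) \ T) := by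
  refine (card_le_card ?_).trans (card_vadd_finset (1 : ZMod p) _).le
  intro y hy
  rw [mem_sdiff, mem_vadd_finset] at hy
  obtain ⟨⟨u, hu, rfl⟩, hyU⟩ := hy
  have huT : u ∉ T := fun h => hyU (mem_union_right _ (mem_vadd_finset.2 ⟨u, h, rfl⟩))
  refine mem_vadd_finset.2 ⟨u, mem_sdiff.2 ⟨?_, huT⟩, rfl⟩
  rcases mem_union.1 hu with h | h
  · exact absurd h huT
  · exact h

/-- Steps count: `i • d = j • d` with `i, j < p`, `d ≠ 0` forces `i = j`. [folklore] -/
theorem nat_eq_of_nsmul_eq' {d : ZMod p} (hd : d ≠ 0) {i j : ℕ} (hi : i < p) (hj : j < p) (h : i • d = j • d) : i = j := by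
  rw [nsmul_eq_mul, nsmul_eq_mul] at h
  have hmod := (ZMod.natCast_eq_natCast_iff' i j p).1 (mul_right_cancel₀ hd h)
  rwa [Nat.mod_eq_of_lt hi, Nat.mod_eq_of_lt hj] at hmod

/-- **Squeeze lemma.**  Let `X ⊆ U ⊊ ℤ/pℤ` contain every run-start (`u ∈ U`, `u − 1 ∉ U`) and every run-last point (`u ∈ U`, `u + 1 ∉ U`)
of `U`, and have no more run-ends than `U`.  Then `X = U`.  Proof: a point `y ∈ U ∖ X` lies in a run of `U` whose start is in `X`; walking
back from `y` one meets a new run-end of `X` strictly inside `U`, in addition to the `|(1+U)∖U|` run-ends of `X` sitting just after the last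
points of `U`. [folklore] -/
theorem eq_of_subset_of_ends {U X : Finset (ZMod p)} (hUu : U ≠ univ) (hXU : X ⊆ U)
    (hSt : ∀ u ∈ U, u - 1 ∉ U → u ∈ X) (hLa : ∀ u ∈ U, u + 1 ∉ U → u ∈ X)
    (hh : #(((1 : ZMod p) +ᵥ X) \ X) ≤ #(((1 : ZMod p) +ᵥ U) \ U)) : X = U := by
  classical
  by_contra hne
  obtain ⟨y, hyU, hyX⟩ : ∃ y ∈ U, y ∉ X := by
    by_contra h
    push Not at h
    exact hne (Subset.antisymm hXU h)
  -- walking back from `y` leaves `U` at some point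
  obtain ⟨c, hc⟩ : ∃ c, c ∉ U := by
    by_contra h
    push Not at h
    exact hUu (eq_univ_of_forall h)
  have hex : ∃ k : ℕ, y - ((k + 1 : ℕ) : ZMod p) ∉ U := by
    refine ⟨(y - 1 - c).val, ?_⟩
    have : y - (((y - 1 - c).val + 1 : ℕ) : ZMod p) = c := by
      push_cast; rw [ZMod.natCast_zmod_val]; ring
    rw [this]; exact hc
  set k₀ := Nat.find hex with hk₀
  have hk₀spec : y - ((k₀ + 1 : ℕ) : ZMod p) ∉ U := Nat.find_spec hex
  have hrun : ∀ j : ℕ, j ≤ k₀ → y - (j : ZMod p) ∈ U := by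
    intro j hj
    rcases Nat.eq_zero_or_pos j with rfl | hjpos
    · rw [Nat.cast_zero, sub_zero]; exact hyU
    · have hlt : j - 1 < k₀ := by omega
      have := Nat.find_min hex hlt
      rw [not_not, show j - 1 + 1 = j by omega] at this
      exact this
  -- the start of this run is in `X`
  have hstart : y - (k₀ : ZMod p) ∈ X := by
    refine hSt _ (hrun k₀ le_rfl) ?_
    have : y - (k₀ : ZMod p) - 1 = y - ((k₀ + 1 : ℕ) : ZMod p) := by push_cast; ring
    rw [this]; exact hk₀spec
  -- the first `j` with `y - j ∈ X`
  have hexX : ∃ j : ℕ, y - (j : ZMod p) ∈ X := ⟨k₀, hstart⟩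
  set j₀ := Nat.find hexX with hj₀
  have hj₀spec : y - (j₀ : ZMod p) ∈ X := Nat.find_spec hexX
  have hj₀le : j₀ ≤ k₀ := Nat.find_min' hexX hstart
  have hj₀pos : 0 < j₀ := by
    rcases Nat.eq_zero_or_pos j₀ with h0 | h
    · rw [h0, Nat.cast_zero, sub_zero] at hj₀spec; exact absurd hj₀spec hyX
    · exact h
  have hprev : y - ((j₀ - 1 : ℕ) : ZMod p) ∉ X := Nat.find_min hexX (by omega)
  -- the new run-end `z = (y - j₀) + 1` of `X`, inside `U`
  set z : ZMod p := y - ((j₀ - 1 : ℕ) : ZMod p) with hz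
  have hzU : z ∈ U := hrun (j₀ - 1) (by omega)
  have hz1 : z = 1 + (y - (j₀ : ZMod p)) := by
    rw [hz, Nat.cast_sub (by omega : 1 ≤ j₀)]; push_cast; ring
  have hzE : z ∈ ((1 : ZMod p) +ᵥ X) \ X :=
    mem_sdiff.2 ⟨mem_vadd_finset.2 ⟨_, hj₀spec, hz1.symm⟩, hprev⟩
  -- every run-end of `U` is a run-end of `X`
  have hsub : ((1 : ZMod p) +ᵥ U) \ U ⊆ ((1 : ZMod p) +ᵥ X) \ X := by
    intro w hw
    rw [mem_sdiff, mem_vadd_finset] at hw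
    obtain ⟨⟨u, hu, rfl⟩, hwU⟩ := hw
    have huX : u ∈ X := hLa u hu (by rwa [add_comm])
    exact mem_sdiff.2 ⟨mem_vadd_finset.2 ⟨u, huX, rfl⟩, fun h => hwU (hXU h)⟩
  have hzne : z ∉ ((1 : ZMod p) +ᵥ U) \ U := fun h => (mem_sdiff.1 h).2 hzU
  have hlt : #(((1 : ZMod p) +ᵥ U) \ U) < #(((1 : ZMod p) +ᵥ X) \ X) :=
    card_lt_card ⟨hsub, fun h => hzne (h hzE)⟩
  omega

/-! ## The normalised theorem when every pair sees three runs -/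

/-- **All three pairs see three runs (normalised Hamidoune–Rødseth, `|S| = 3`).**  `S = {0, 1, v}` (`v ≠ 0, 1`), `|T| ≥ 4`, `|T| + 7 ≤ p`,
`|S + T| = |T| + 3`, `|(1+T)∖T| = |(v+T)∖T| = |((v−1)+T)∖T| = 3` ⇒ `S` lies in a 4-term and `T` in a `(|T|+1)`-term progression with a
common difference (in fact `±2⁻¹`; the sub-case where `T ∪ (1+T)` has three run-ends is contradictory).
[cite: HamidouneRodseth2000, main theorem (§1, p. 252), case |A| = 3] [cite: Vosper1956, main theorem] -/
theorem hr3_of_all_runs_three {v : ZMod p} (hv0 : v ≠ 0) (hv1 : v ≠ 1) {T : Finset (ZMod p)} (hT4 : 4 ≤ #T) (hTp : #T + 7 ≤ p)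
    (hr1 : #(((1 : ZMod p) +ᵥ T) \ T) = 3) (hrv : #((v +ᵥ T) \ T) = 3) (hrv1 : #(((v - 1) +ᵥ T) \ T) = 3)
    (hsum : #(({0, 1, v} : Finset (ZMod p)) + T) = #T + 3) :
    ∃ d s t : ZMod p, ({0, 1, v} : Finset (ZMod p)) ⊆ apFinset s d 4 ∧ T ⊆ apFinset t d (#T + 1) := by
  classical
  set U := T ∪ ((1 : ZMod p) +ᵥ T) with hU
  have hUcard : #U = #T + 3 := by
    have := card_sdiff_add_card ((1 : ZMod p) +ᵥ T) T
    rw [union_comm] at this; rw [hU]; omega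
  have hST : ({0, 1, v} : Finset (ZMod p)) + T = U ∪ (v +ᵥ T) := triple_add_eq v T
  have hSTU : ({0, 1, v} : Finset (ZMod p)) + T = U := by
    have hsub : U ⊆ ({0, 1, v} : Finset (ZMod p)) + T := by rw [hST]; exact subset_union_left
    exact (eq_of_subset_of_card_le hsub (by rw [hsum, hUcard])).symm
  have hvT : v +ᵥ T ⊆ U := by rw [← hSTU, hST]; exact subset_union_right
  have hUu : U ≠ univ := by
    intro h
    have : #U = p := by rw [h, card_univ, ZMod.card]
    omega
  have hUle : #(((1 : ZMod p) +ᵥ U) \ U) ≤ 3 := (card_vadd_sdiff_union_le T).trans hr1.le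
  by_cases hU3 : #(((1 : ZMod p) +ᵥ U) \ U) = 3
  · -- contradiction: `v + T` would have to be all of `U`
    exfalso
    -- run-last points of `U` = `(1+T) ∖ T` ⊆ `v + T`
    have hE : ((1 : ZMod p) +ᵥ T) \ T ⊆ v +ᵥ T := by
      have h1 : (v +ᵥ T) \ T ⊆ ((1 : ZMod p) +ᵥ T) \ T := by
        intro y hy
        rw [mem_sdiff] at hy ⊢
        refine ⟨?_, hy.2⟩
        rcases mem_union.1 (hvT hy.1) with h | h
        · exact absurd h hy.2
        · exact h
      have := eq_of_subset_of_card_le h1 (by rw [hr1, hrv])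
      rw [← this]; exact sdiff_subset
    -- run-starts of `U` = `T ∖ (1+T)` ⊆ `v + T`
    have hS : T \ ((1 : ZMod p) +ᵥ T) ⊆ v +ᵥ T := by
      have h1 : (v +ᵥ T) \ ((1 : ZMod p) +ᵥ T) ⊆ T \ ((1 : ZMod p) +ᵥ T) := by
        intro y hy
        rw [mem_sdiff] at hy ⊢
        refine ⟨?_, hy.2⟩
        rcases mem_union.1 (hvT hy.1) with h | h
        · exact h
        · exact absurd h hy.2
      have hc1 : #((v +ᵥ T) \ ((1 : ZMod p) +ᵥ T)) = 3 := by
        have : (v +ᵥ T) \ ((1 : ZMod p) +ᵥ T) = (1 : ZMod p) +ᵥ (((v - 1) +ᵥ T) \ T) := by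
          rw [vadd_finset_sdiff, vadd_vadd, add_sub_cancel]
        rw [this, card_vadd_finset, hrv1]
      have hc2 : #(T \ ((1 : ZMod p) +ᵥ T)) = 3 := by
        have h2 := card_sdiff_add_card_inter T ((1 : ZMod p) +ᵥ T)
        have h3 := card_sdiff_add_card_inter ((1 : ZMod p) +ᵥ T) T
        rw [card_vadd_finset, inter_comm] at h3
        omega
      have := eq_of_subset_of_card_le h1 (by rw [hc1, hc2])
      rw [← this]; exact sdiff_subset
    have hX : v +ᵥ T = U := by
      refine eq_of_subset_of_ends hUu hvT ?_ ?_ ?_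
      · intro u hu hu1
        refine hS (mem_sdiff.2 ⟨?_, fun h => ?_⟩)
        · rcases mem_union.1 hu with h | h
          · exact h
          · exfalso
            obtain ⟨t, ht, rfl⟩ := mem_vadd_finset.1 h
            exact hu1 (mem_union_left _ (by rwa [vadd_eq_add, add_sub_cancel_left]))
        · obtain ⟨t, ht, rfl⟩ := mem_vadd_finset.1 h
          exact hu1 (mem_union_left _ (by rwa [vadd_eq_add, add_sub_cancel_left]))
      · intro u hu hu1
        refine hE (mem_sdiff.2 ⟨?_, fun h => hu1 (mem_union_right _ (mem_vadd_finset.2 ⟨u, h, by rw [vadd_eq_add, add_comm]⟩))⟩)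
        rcases mem_union.1 hu with h | h
        · exact absurd (mem_union_right _ (mem_vadd_finset.2 ⟨u, h, by rw [vadd_eq_add, add_comm]⟩)) hu1
        · exact h
      · rw [card_vadd_sdiff_vadd, hr1, hU3]
    have := congrArg Finset.card hX
    rw [card_vadd_finset, hUcard] at this
    omega
  · -- `U` has at most two run-ends: the pair `(S, U)` is Vosper-critical
    have hU2 : #(((1 : ZMod p) +ᵥ U) \ U) ≤ 2 := by omega
    have hS1 : ({0, 1, v} : Finset (ZMod p)) + ((1 : ZMod p) +ᵥ T) = (1 : ZMod p) +ᵥ U := by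
      rw [add_comm, vadd_add_assoc, add_comm T, hSTU]
    have hSU : ({0, 1, v} : Finset (ZMod p)) + U = U ∪ ((1 : ZMod p) +ᵥ U) := by
      conv_lhs => rw [hU]
      rw [add_union, hSTU, hS1]
    have hSUcard : #(({0, 1, v} : Finset (ZMod p)) + U) ≤ #U + 2 := by
      have := card_sdiff_add_card ((1 : ZMod p) +ᵥ U) U
      rw [union_comm] at this; rw [hSU]; omega
    have hS3 := card_triple hv0 hv1
    have hUne : U.Nonempty := by
      rw [hU]; exact (card_pos.1 (by omega : 0 < #T)).mono subset_union_left
    have hcd := ZMod.cauchy_davenport hp.out (s := ({0, 1, v} : Finset (ZMod p))) (t := U) ⟨0, by simp⟩ hUne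
    rw [hS3, hUcard] at hcd
    have hSUeq : #(({0, 1, v} : Finset (ZMod p)) + U) = #T + 5 := by
      rw [min_eq_right (by omega)] at hcd; omega
    have hU2' : #(((1 : ZMod p) +ᵥ U) \ U) = 2 := by
      have := card_sdiff_add_card ((1 : ZMod p) +ᵥ U) U
      rw [union_comm, ← hSU, hSUeq, hUcard] at this; omega
    obtain ⟨d, hd, ⟨s, hSap⟩, ⟨u, hUap⟩⟩ :=
      vosper_inverse (A := ({0, 1, v} : Finset (ZMod p))) (B := U) (by rw [hS3]; norm_num) (by rw [hUcard]; omega)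
        (by omega) (by omega)
    rw [hS3] at hSap
    rw [hUcard] at hUap
    -- `0` and `1` as terms of the progression `S`
    have h0 : (0 : ZMod p) ∈ apFinset s d 3 := by rw [← hSap]; simp
    have h1 : (1 : ZMod p) ∈ apFinset s d 3 := by rw [← hSap]; simp
    obtain ⟨i, hi, hi0⟩ := mem_apFinset.1 h0
    obtain ⟨j, hj, hj1⟩ := mem_apFinset.1 h1
    -- `d = ±1` is impossible: `U` would have a single run-end
    have hnot1 : d ≠ 1 := by
      intro hd1
      have := card_vadd_sdiff_apFinset_le_one u d (#T + 3)
      rw [← hUap, hd1] at this; omega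
    have hnotm1 : d ≠ -1 := by
      intro hd1
      have := card_vadd_sdiff_apFinset_le_one u d (#T + 3)
      rw [← hUap, hd1, card_neg_vadd_sdiff] at this; omega
    have hp0 : ((p : ℕ) : ZMod p) = 0 := ZMod.natCast_self p
    -- so `2 • d = ±1`
    have h2d : (2 : ZMod p) * d = 1 ∨ (2 : ZMod p) * d = -1 := by
      rw [nsmul_eq_mul] at hi0 hj1
      have key : (1 : ZMod p) = ((j : ZMod p) - (i : ZMod p)) * d := by linear_combination hi0 - hj1
      interval_cases i <;> interval_cases j <;> push_cast at key
      · exact ((one_ne_zero (α := ZMod p)) (by linear_combination key)).elim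
      · exact (hnot1 (by linear_combination -key)).elim
      · left; linear_combination -key
      · exact (hnotm1 (by linear_combination key)).elim
      · exact ((one_ne_zero (α := ZMod p)) (by linear_combination key)).elim
      · exact (hnot1 (by linear_combination -key)).elim
      · right; linear_combination key
      · exact (hnotm1 (by linear_combination key)).elim
      · exact ((one_ne_zero (α := ZMod p)) (by linear_combination key)).elim
    have hSsub : ({0, 1, v} : Finset (ZMod p)) ⊆ apFinset s d 4 := by
      rw [hSap]; exact apFinset_mono s d (by norm_num)
    -- indices of points of `T` in `U`
    have hidx : ∀ x ∈ T, ∃ i', i' < #T + 3 ∧ u + i' • d = x := fun x hx =>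
      mem_apFinset.1 (by rw [← hUap]; exact mem_union_left _ hx)
    have hidx1 : ∀ x ∈ T, ∃ j', j' < #T + 3 ∧ u + j' • d = x + 1 := fun x hx =>
      mem_apFinset.1 (by rw [← hUap]; exact mem_union_right _ (mem_vadd_finset.2 ⟨x, hx, add_comm _ _⟩))
    rcases h2d with h2 | h2
    · refine ⟨d, s, u, hSsub, fun x hx => ?_⟩
      obtain ⟨i', hi', hxi⟩ := hidx x hx
      obtain ⟨j', hj', hxj⟩ := hidx1 x hx
      have hij : (i' + 2) • d = j' • d := by
        rw [add_nsmul, nsmul_eq_mul 2]; push_cast; linear_combination hxi - hxj + h2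
      have := nat_eq_of_nsmul_eq' hd (by omega) (by omega) hij
      exact mem_apFinset.2 ⟨i', by omega, hxi⟩
    · refine ⟨d, s, u + 2 • d, hSsub, fun x hx => ?_⟩
      obtain ⟨i', hi', hxi⟩ := hidx x hx
      obtain ⟨j', hj', hxj⟩ := hidx1 x hx
      have hij : i' • d = (j' + 2) • d := by
        rw [add_nsmul, nsmul_eq_mul 2]; push_cast; linear_combination hxi - hxj - h2
      have := nat_eq_of_nsmul_eq' hd (by omega) (by omega) hij
      refine mem_apFinset.2 ⟨j', by omega, ?_⟩
      rw [← hxi, this, add_nsmul]; abel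

end Summit.MatrixMultiplication.OmegaCensus.HR3
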